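import Summits.ValiantsHypothesis.ValiantsHypothesis.Theorems.RigidityForcesSymmetryGrenetFirstOrderRankRigidExtraCellPaths
import Summits.ValiantsHypothesis.ValiantsHypothesis.Theorems.RigidityForcesSymmetryGrenetFirstOrderRankRigidPermSlices
import Summits.ValiantsHypothesis.ValiantsHypothesis.Theorems.RigidityForcesSymmetryGrenetFirstOrderRankRigidOverlapPoint

/-!
# Route RigidityForcesSymmetry — `GrenetFirstOrderRankRigid` (item stmt-ValiantsHypothesis-21029),
line `grenet_gauge`: stub `stub_linearRigid`, step 5 (block II, borders) — bookkeeping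

For the crux line `Cruxes/GrenetFirstOrderRankRigid/Lines/grenet_gauge.lean` (blueprint
`Lines/grenet_gauge-stub_linearRigid-PROOF.md`, §5, block II, borders `k = n - a` and `k = 0`; binders
`hTu` / `hH0` of `grenet_linearRigid_of_blockII`, `…FinalModuloII`).  Small lemmas for the border blocks:
`border_column_shape` (at the top border `s₀ = n - 1` the column weights and the rank constraint leave
only the tail shape), `exists_perm_prefix_last` (an ordering with prescribed prefix set and prescribed
last letter).  No new definitions.  VP ≠ VNP is not moved by this file.
-/

noncomputable section

open MvPolynomial Matrix Finset

namespace Summit.ValiantsHypothesis.Theorems.RigidityForcesSymmetry.GrenetGauge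

open Literature.Computability.AlgebraicComplexity

/-! ### Bookkeeping -/

section BorderShape

variable {n : ℕ}

/-- **Column weights at the top border.**  If `[c < s] + [t ≤ c] + [c = q] = [c < s₀] + [t₀ ≤ c] + [c = s₀]`
on `[0, n)` with `t₀ ≤ s₀ = n - 1`, `s < n`, and the entry is a tail (`q = s`) or a head (`t = q + 1`),
then `(s, t, q) = (s₀, t₀, s₀)`. [folklore] -/
theorem border_column_shape {s₀ t₀ s t q : ℕ} (hts : t₀ ≤ s₀) (hs₀ : s₀ + 1 = n) (hs : s < n)
    (h : ∀ c, c < n → (if c < s then 1 else 0) + (if t ≤ c then 1 else 0) + (if c = q then 1 else 0)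
      = (if c < s₀ then 1 else 0) + (if t₀ ≤ c then 1 else 0) + (if c = s₀ then (1 : ℕ) else 0))
    (hth : q = s ∨ t = q + 1) : s = s₀ ∧ t = t₀ ∧ q = s₀ := by
  have h1 := h s₀ (by omega)
  rw [if_neg (lt_irrefl _), if_pos hts, if_pos rfl] at h1
  rcases hth with hqs | htq
  · have k1 : t ≤ s₀ ∧ s₀ ≤ q := by split_ifs at h1 <;> omega
    have k2 : q = s₀ := by omega
    have h3 : t ≤ t₀ := by
      have hc := h t₀ (by omega)
      rw [if_pos (le_refl _)] at hc
      split_ifs at hc <;> omega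
    have h4 : t = t₀ := by
      by_contra hne
      have hc := h t (by omega)
      rw [if_pos (le_refl _)] at hc
      split_ifs at hc <;> omega
    exact ⟨by omega, h4, k2⟩
  · exfalso
    split_ifs at h1 <;> omega

/-- An ordering of `Fin n` with a prescribed prefix set `L` and a prescribed LAST element `x ∉ L`.
[folklore] -/
theorem exists_perm_prefix_last (L : Finset (Fin n)) (x : Fin n) (hx : x ∉ L) :
    ∃ π : Equiv.Perm (Fin n), (univ.filter fun i : Fin n => (i : ℕ) < L.card).image π = L ∧
      ∀ c : Fin n, (c : ℕ) = n - 1 → π c = x := by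
  obtain ⟨σ, hσ⟩ := Grenet.exists_perm_prefix_image_eq L
  have hLn : L.card < n := by
    have h1 : (insert x L).card ≤ n := (Finset.card_le_univ _).trans_eq (Fintype.card_fin n)
    rw [Finset.card_insert_of_notMem hx] at h1
    omega
  have hi₀ : L.card ≤ ((σ.symm x : Fin n) : ℕ) := by
    by_contra hlt
    have : x ∈ (univ.filter fun i : Fin n => (i : ℕ) < L.card).image σ :=
      (Grenet.mem_prefix_image σ _ x).mpr (not_le.mp hlt)
    rw [hσ] at this
    exact hx this
  refine ⟨σ * Equiv.swap (σ.symm x) ⟨n - 1, by omega⟩, ?_, ?_⟩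
  · refine (Grenet.prefix_image_eq_of_eqOn_lt (fun i hi => ?_) le_rfl).trans hσ
    rw [Equiv.Perm.mul_apply, Equiv.swap_apply_of_ne_of_ne]
    · intro h'; rw [h'] at hi; omega
    · intro h'; have := congrArg Fin.val h'; simp only at this; omega
  · intro c hc
    have hcc : c = ⟨n - 1, by omega⟩ := Fin.ext hc
    rw [hcc, Equiv.Perm.mul_apply, Equiv.swap_apply_right, Equiv.apply_symm_apply]


/-- **Column weights at the bottom border.**  If `[c < s] + [t ≤ c] + [c = q] = [c < a] + [1 ≤ c] + [c = 0]`
on `[0, n)` with `1 ≤ a < n`, `1 ≤ t`, `s < n`, and the entry is a tail (`q = s`) or a head (`t = q + 1`),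
then `(s, t, q) = (a, 1, 0)`. [folklore] -/
theorem border_column_shape_bot {a s t q : ℕ} (ha : 1 ≤ a) (han : a < n) (ht : 1 ≤ t) (hs : s < n)
    (h : ∀ c, c < n → (if c < s then 1 else 0) + (if t ≤ c then 1 else 0) + (if c = q then 1 else 0)
      = (if c < a then 1 else 0) + (if 1 ≤ c then 1 else 0) + (if c = 0 then (1 : ℕ) else 0))
    (hth : q = s ∨ t = q + 1) : s = a ∧ t = 1 ∧ q = 0 := by
  have h0 := h 0 (by omega)
  rw [if_pos (by omega : 0 < a), if_neg (by omega : ¬ 1 ≤ 0), if_pos rfl] at h0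
  rcases hth with hqs | htq
  · exfalso
    split_ifs at h0 <;> omega
  · have k1 : q = 0 ∧ 0 < s := by split_ifs at h0 <;> omega
    have k2 : a ≤ s := by
      have hc := h s hs
      rw [if_neg (lt_irrefl _)] at hc
      split_ifs at hc <;> omega
    have k3 : s ≤ a := by
      have hc := h a han
      rw [if_neg (lt_irrefl _), if_pos ha, if_neg (by omega : a ≠ 0)] at hc
      split_ifs at hc <;> omega
    exact ⟨by omega, by omega, k1.1⟩

/-- An ordering of `Fin n` with a prescribed prefix set `L` and a prescribed FIRST element `x ∈ L`.
[folklore] -/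
theorem exists_perm_prefix_first (L : Finset (Fin n)) (x : Fin n) (hx : x ∈ L) :
    ∃ π : Equiv.Perm (Fin n), (univ.filter fun i : Fin n => (i : ℕ) < L.card).image π = L ∧
      ∀ c : Fin n, (c : ℕ) = 0 → π c = x := by
  obtain ⟨σ, hσ⟩ := Grenet.exists_perm_prefix_image_eq L
  have hn : 0 < n := Fin.pos x
  have hi₀ : ((σ.symm x : Fin n) : ℕ) < L.card := by
    rw [← Grenet.mem_prefix_image σ, hσ]; exact hx
  refine ⟨σ * Equiv.swap (σ.symm x) ⟨0, hn⟩, ?_, ?_⟩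
  · refine Eq.trans ?_ hσ
    ext y
    rw [Grenet.mem_prefix_image, Grenet.mem_prefix_image]
    have hsy : (σ * Equiv.swap (σ.symm x) ⟨0, hn⟩).symm y = Equiv.swap (σ.symm x) ⟨0, hn⟩ (σ.symm y) := by
      rw [Equiv.Perm.mul_def, Equiv.symm_trans_apply, Equiv.symm_swap]
    have hL0 : 0 < L.card := Nat.zero_lt_of_lt hi₀
    rw [hsy, Equiv.swap_apply_def]
    split_ifs with h1 h2
    · rw [h1]; exact ⟨fun _ => hi₀, fun _ => hL0⟩
    · rw [h2]; exact ⟨fun _ => hL0, fun _ => hi₀⟩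
    · exact Iff.rfl
  · intro c hc
    have hcc : c = ⟨0, hn⟩ := Fin.ext hc
    rw [hcc, Equiv.Perm.mul_apply, Equiv.swap_apply_right, Equiv.apply_symm_apply]

end BorderShape

end Summit.ValiantsHypothesis.Theorems.RigidityForcesSymmetry.GrenetGauge
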